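import Literature.Computability.AlgebraicComplexity.BILPS19MinrankVarieties
import HarnessLib

/-!
# BILPS Cor 25 from Thm 24 (the printed one-line derivation)

Glue file (theorem-only) for `BILPS19MinrankVarieties.lean` (Bläser–Ikenmeyer–Lysikov–Pandey–Schreyer,
arXiv:1911.02534, Cor 25, p0026:L1–3: "In this case we have `dim Λ^p U* ⊗ V = binom(k,p) m =
binom(k-1,p) (k/(k-p)) m` and `rk F_{T,p} ≤ binom(k-1,p)(r + (k-p-1)/(p+1)·n + p/(k-p)·m) =
binom(k-1,p)(r + (k-1)/(k-p)·m) < binom(k-1,p) (k/(k-p)) m`."): `BILPS2019_thm24 → BILPS2019_cor25`,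
so that Cor 25 is dischargeable BY NAME from a discharge of Thm 24. Honest framing (val-lit): the
printed arithmetic, no new facts; nothing here bears on `VP ≠ VNP`.
-/

namespace Literature.Computability.AlgebraicComplexity

/-- `binom(k-1, p) · k = binom(k, p) · (k - p)` in `ℚ`, for `p < k`.
[cite: BlaserIkenmeyerLysikovPandeySchreyer2019, Cor. 25 (proof)] -/
theorem choose_pred_mul_cast {k p : ℕ} (hpk : p < k) :
    (((k - 1).choose p : ℕ) : ℚ) * k = ((k.choose p : ℕ) : ℚ) * ((k : ℚ) - p) := by
  have h := Nat.choose_mul_succ_eq (k - 1) p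
  rw [Nat.sub_add_cancel (by omega : 1 ≤ k)] at h
  have h' := congrArg (Nat.cast (R := ℚ)) h
  push_cast [Nat.cast_sub hpk.le] at h'
  linarith

/-- **Cor 25 from Thm 24** (the printed derivation). [cite: BlaserIkenmeyerLysikovPandeySchreyer2019, Cor. 25] -/
theorem BILPS2019_cor25_of_thm24 (h : BILPS2019_thm24) : BILPS2019_cor25 := by
  intro F _ _ _ k m n p r T hp hpk hshape hr hT
  have h24 := h F k m n p r T hp hpk hT
  have hkp : (0 : ℚ) < (k : ℚ) - p := by
    have : (p : ℚ) < k := by exact_mod_cast hpk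
    linarith
  have hshape' : ((k : ℚ) - p) * n = ((p : ℚ) + 1) * m := by
    have h' := congrArg (Nat.cast (R := ℚ)) hshape
    push_cast [Nat.cast_sub hpk.le] at h'
    linarith
  have hC := choose_pred_mul_cast hpk
  have hCpos : (0 : ℚ) < (((k - 1).choose p : ℕ) : ℚ) := by
    exact_mod_cast Nat.choose_pos (by omega)
  have hmin1 : min (m : ℚ) (((k : ℚ) - p - 1) / (p + 1) * n) ≤ ((k : ℚ) - p - 1) * m / ((k : ℚ) - p) := by
    refine (min_le_right _ _).trans (le_of_eq ?_)
    have hp1 : (0 : ℚ) < (p : ℚ) + 1 := by positivity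
    field_simp
    nlinarith [hshape']
  have hmin2 : min (n : ℚ) ((p : ℚ) / (k - p) * m) ≤ (p : ℚ) * m / ((k : ℚ) - p) :=
    (min_le_right _ _).trans (le_of_eq (by rw [div_mul_eq_mul_div]))
  have key : ((koszulMatrix p T).rank : ℚ) < ((k.choose p * m : ℕ) : ℚ) := by
    calc ((koszulMatrix p T).rank : ℚ)
        ≤ ((k - 1).choose p : ℚ) *
            (r + min (m : ℚ) (((k : ℚ) - p - 1) / (p + 1) * n) + min (n : ℚ) ((p : ℚ) / (k - p) * m)) :=
          h24
      _ ≤ ((k - 1).choose p : ℚ) *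
            (r + ((k : ℚ) - p - 1) * m / ((k : ℚ) - p) + (p : ℚ) * m / ((k : ℚ) - p)) :=
          mul_le_mul_of_nonneg_left (add_le_add (add_le_add le_rfl hmin1) hmin2) hCpos.le
      _ < ((k - 1).choose p : ℚ) *
            ((m : ℚ) / (k - p) + ((k : ℚ) - p - 1) * m / ((k : ℚ) - p) + (p : ℚ) * m / ((k : ℚ) - p)) :=
          mul_lt_mul_of_pos_left (by linarith) hCpos
      _ = ((k.choose p * m : ℕ) : ℚ) := by
          push_cast
          field_simp
          linear_combination (m : ℚ) * hC
  exact_mod_cast key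

end Literature.Computability.AlgebraicComplexity
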